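import Summits.Schanuel.Schanuel.Theses.RoyCriterion
import Literature.Barriers.Schanuel.LargeTranscendenceDegreeThm29Holds
import Literature.Barriers.Schanuel.NesterenkoModularScopeConjectureProofs

-- `Summit.Schanuel.Schanuel.…` is the mandated layout of this single-problem summit (CONVENTIONS §1).
set_option linter.dupNamespace false

/-!
# Route `RoyCriterion`, crux `SchanuelTwo` (stmt-Schanuel-0069), line `CardA_BW` — stub
# `stub_gridRichSector`: the LNM 1752 Ch. 14 Thm 2.9 `t₂` grid-rich sector

The crux is Schanuel's conjecture for `n = 2`: for `x : Fin 2 → ℂ` linearly independent over `ℚ`,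
`2 ≤ trdeg_ℚ K_x` with `K_x = ℚ(x, e^x) = IntermediateField.adjoin ℚ (range x ∪ range (exp ∘ x))`.
Line `CardA_BW` (card `Cruxes/SchanuelTwo/Ideas/bw-log-rich-planes.md`, the "(2,3) family"
generalised) is a sector atlas; this file is the GRID-RICH sector: if there are, algebraic over
`K_x`, a `ℚ`-linearly independent `X : Fin d → ℂ`, a `ℚ`-linearly independent `Y : Fin ℓ → ℂ` with
`ℓ + d < dℓ`, and all `dℓ` exponentials `e^{Xᵢ Yⱼ}`, then `2 ≤ trdeg_ℚ K_x`.

Engine: `Literature.Barriers.Schanuel.two_le_trdeg_gridField₂`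
(`Literature/Barriers/Schanuel/LargeTranscendenceDegreeThm29Holds.lean`, PROVED in tree): the
`t₂`-clause of LNM 1752 Ch. 14 Theorem 2.9, `2 ≤ trdeg_ℚ ℚ(X, Y, e^{XᵢYⱼ})` for `ℓ + d < dℓ`.
Bookkeeping: the grid data `T = range X ∪ range Y ∪ range (e^{XᵢYⱼ})` is adjoined to `K_x = ℚ(S)`
at no cost in transcendence degree
(`Literature.Barriers.Schanuel.trdeg_adjoin_union_eq_of_isAlgebraic_adjoin`), and
`ℚ(X, Y, e^{XᵢYⱼ}) = gridField₂ X Y ≤ ℚ(S ∪ T)` gives `2 ≤ trdeg ℚ(S ∪ T) = trdeg K_x` by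
monotonicity (`Literature.Barriers.Schanuel.trdeg_mono`).

No definitions, no sorry; axioms `propext`, `Classical.choice`, `Quot.sound`.
-/

noncomputable section

open Complex IntermediateField

namespace Summit.Schanuel.Schanuel.Theorems

/-- **Grid-rich sector** of line `CardA_BW` for crux `SchanuelTwo`: if `K_x = ℚ(x, e^x)` has,
algebraic over it, a `ℚ`-linearly independent `X : Fin d → ℂ`, a `ℚ`-linearly independent
`Y : Fin ℓ → ℂ` with `ℓ + d < dℓ`, and all the exponentials `e^{Xᵢ Yⱼ}`, then `2 ≤ trdeg_ℚ K_x`.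
Proof: LNM 1752 Ch. 14 Theorem 2.9 (`t₂`), tree theorem
`Literature.Barriers.Schanuel.two_le_trdeg_gridField₂`, gives `2 ≤ trdeg_ℚ ℚ(X, Y, e^{XᵢYⱼ})`;
this field sits inside `ℚ(S ∪ T)` (`S = range x ∪ range (exp ∘ x)`, `T` the grid data), whose
transcendence degree equals that of `ℚ(S) = K_x` because `T` is algebraic over `ℚ(S)`.
[cite: NesterenkoPhilippon2001, Ch. 14 Theorem 2.9] -/
theorem stub_gridRichSector :
    ∀ (x : Fin 2 → ℂ) (d l : ℕ) (X : Fin d → ℂ) (Y : Fin l → ℂ), l + d < d * l →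
      LinearIndependent ℚ X → LinearIndependent ℚ Y →
      (∀ i, IsAlgebraic ↥(IntermediateField.adjoin ℚ (Set.range x ∪ Set.range (Complex.exp ∘ x))) (X i)) →
      (∀ j, IsAlgebraic ↥(IntermediateField.adjoin ℚ (Set.range x ∪ Set.range (Complex.exp ∘ x))) (Y j)) →
      (∀ i j, IsAlgebraic ↥(IntermediateField.adjoin ℚ (Set.range x ∪ Set.range (Complex.exp ∘ x)))
        (Complex.exp (X i * Y j))) →
      (2 : Cardinal) ≤ Algebra.trdeg ℚ
        ↥(IntermediateField.adjoin ℚ (Set.range x ∪ Set.range (Complex.exp ∘ x))) := by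
  intro x d l X Y hdl hX hY hXa hYa hE
  set S : Set ℂ := Set.range x ∪ Set.range (Complex.exp ∘ x)
  set T : Set ℂ :=
    Set.range X ∪ Set.range Y ∪ Set.range (fun p : Fin d × Fin l => cexp (X p.1 * Y p.2))
  have hT : ∀ z ∈ T, IsAlgebraic (adjoin ℚ S) z := by
    rintro z ((⟨i, rfl⟩ | ⟨j, rfl⟩) | ⟨⟨i, j⟩, rfl⟩)
    exacts [hXa i, hYa j, hE i j]
  have hle : Literature.Barriers.Schanuel.gridField₂ X Y ≤ adjoin ℚ (S ∪ T) := by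
    unfold Literature.Barriers.Schanuel.gridField₂
    exact adjoin.mono ℚ _ _ Set.subset_union_right
  calc (2 : Cardinal) ≤ Algebra.trdeg ℚ (Literature.Barriers.Schanuel.gridField₂ X Y) :=
        Literature.Barriers.Schanuel.two_le_trdeg_gridField₂ X Y hX hY hdl
    _ ≤ Algebra.trdeg ℚ (adjoin ℚ (S ∪ T)) := Literature.Barriers.Schanuel.trdeg_mono hle
    _ = Algebra.trdeg ℚ (adjoin ℚ S) :=
        Literature.Barriers.Schanuel.trdeg_adjoin_union_eq_of_isAlgebraic_adjoin S T hT

end Summit.Schanuel.Schanuel.Theorems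

end
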